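import Literature.NumberTheory.Transcendental.KZDilationStokesDescentPrep
import HarnessLib

/-!
# Stokes descent for the dilation pencil, III: the dilated Stokes identity and its kernel

Dilation functions `v_g(ϖ) = ∫_{[0,1]^n} g(ϖz) dz` (route `KontsevichZagierPeriods/LiftingCriteria`,
crux `DilationLiftAtOne`). For a rational potential `B = P/Q ∈ ℚ(x₀, x₁, …, x_d)` regular on an
open box `(a,b)^{1+d} ⊇ [0,1]^{1+d}` and `h := ∂₀B`, the STOKES DESCENT identity holds on ALL of
`[0,1]` (`dilation_integral_pderiv_zero`):
  `v_h(ϖ) = v_k(ϖ) + (ϖ − 1)·∫_{[0,1]^d} Ψ₁(ϖ, ϖu) du`,   `k(u) := B(1,u) − B(0,u)`,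
with the kernel `Ψ₁ = N₁/(Q·Q(0,·)·Q(1,·))` (`N₁` the Stokes quotient of
`KZDilationStokesQuotient.lean`) a regular rational function, hence Nash, on the box
(`isSemialgebraicFunOn_kernel`, `analyticOnNhd_kernel`): `v_{∂₀B} ≡ v_{B(1,·)−B(0,·)}`
modulo `(ϖ − 1)·D'` with an explicit twisted-diagonal Nash kernel — the Stokes sector of the
functional half ("moves lift") of the dilation lifting problem, for rational potentials, with no
analytic division. Proof: `KZDilationStokesDescentPrep.lean` (Fubini, FTC, exact division, value
at `0`).

Everything is proved; no `def`, no named fact.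

## References
* M. Kontsevich, D. Zagier, *Periods* (2001), §1.2 (Stokes as one of the three rules).
  [`KontsevichZagier2001`]
-/

noncomputable section

open Set MeasureTheory intervalIntegral
open scoped BigOperators Topology
open Literature.ModelTheory.ExponentialFields (IsSemialgebraic analyticOnNhd_aeval continuous_aeval_real)

namespace Literature.NumberTheory.Transcendental

namespace KZ.StokesDescent

variable {d : ℕ}

/-! ### The dilated Stokes identity on all of `[0,1]` -/

/-- **Stokes descent (dilated Stokes identity).** For `B = P/Q` regular on the box
`(a,b)^{1+d} ⊇ [0,1]^{1+d}`, `h = ∂₀B`, `k(w) = B(1,w) − B(0,w)` and the kernel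
`Ψ₁ = N₁/(Q·Q(0,·)·Q(1,·))` (`N₁` the Stokes quotient), for every `ϖ ∈ [0,1]`:
`∫_{[0,1]^{1+d}} h(ϖz) dz = ∫_{[0,1]^d} k(ϖu) du + (ϖ − 1)·∫_{[0,1]^d} Ψ₁(ϖ, ϖu) du`.
[cite: KontsevichZagier2001, §1.2] -/
theorem dilation_integral_pderiv_zero {a b : ℝ} (ha : a < 0) (hb : 1 < b)
    (P Q N₁ : MvPolynomial (Fin (d + 1)) ℚ)
    (hQ : ∀ p ∈ Set.pi Set.univ (fun _ : Fin (d + 1) => Ioo a b), MvPolynomial.aeval p Q ≠ 0)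
    (hN : ∀ (t : ℝ) (u : Fin d → ℝ),
      (MvPolynomial.aeval (Fin.cons t u : Fin (d + 1) → ℝ) P *
            MvPolynomial.aeval (Fin.cons 0 u : Fin (d + 1) → ℝ) Q -
          MvPolynomial.aeval (Fin.cons 0 u : Fin (d + 1) → ℝ) P *
            MvPolynomial.aeval (Fin.cons t u : Fin (d + 1) → ℝ) Q) *
          MvPolynomial.aeval (Fin.cons 1 u : Fin (d + 1) → ℝ) Q -
        t * (MvPolynomial.aeval (Fin.cons 1 u : Fin (d + 1) → ℝ) P *
              MvPolynomial.aeval (Fin.cons 0 u : Fin (d + 1) → ℝ) Q -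
            MvPolynomial.aeval (Fin.cons 0 u : Fin (d + 1) → ℝ) P *
              MvPolynomial.aeval (Fin.cons 1 u : Fin (d + 1) → ℝ) Q) *
          MvPolynomial.aeval (Fin.cons t u : Fin (d + 1) → ℝ) Q =
      t * (t - 1) * MvPolynomial.aeval (Fin.cons t u : Fin (d + 1) → ℝ) N₁)
    {ϖ : ℝ} (hϖ : ϖ ∈ Icc (0:ℝ) 1) :
    (∫ z in Set.pi Set.univ (fun _ : Fin (d + 1) => Icc (0:ℝ) 1),
      (MvPolynomial.aeval (ϖ • z) (MvPolynomial.pderiv 0 P) * MvPolynomial.aeval (ϖ • z) Q -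
          MvPolynomial.aeval (ϖ • z) P * MvPolynomial.aeval (ϖ • z) (MvPolynomial.pderiv 0 Q)) /
        (MvPolynomial.aeval (ϖ • z) Q) ^ 2) =
      (∫ u in Set.pi Set.univ (fun _ : Fin d => Icc (0:ℝ) 1),
        (MvPolynomial.aeval (Matrix.vecCons 1 (ϖ • u)) P /
            MvPolynomial.aeval (Matrix.vecCons 1 (ϖ • u)) Q -
          MvPolynomial.aeval (Matrix.vecCons 0 (ϖ • u)) P /
            MvPolynomial.aeval (Matrix.vecCons 0 (ϖ • u)) Q)) +
      (ϖ - 1) * ∫ u in Set.pi Set.univ (fun _ : Fin d => Icc (0:ℝ) 1),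
        MvPolynomial.aeval (Matrix.vecCons ϖ (ϖ • u)) N₁ /
          (MvPolynomial.aeval (Matrix.vecCons ϖ (ϖ • u)) Q *
            MvPolynomial.aeval (Matrix.vecCons 0 (ϖ • u)) Q *
            MvPolynomial.aeval (Matrix.vecCons 1 (ϖ • u)) Q) := by
  -- continuity of polynomial functions along continuous maps
  have hc : ∀ {m : ℕ} (R : MvPolynomial (Fin (d + 1)) ℚ) {φ : (Fin m → ℝ) → (Fin (d + 1) → ℝ)},
      Continuous φ → Continuous fun u => MvPolynomial.aeval (φ u) R := fun R _ hφ =>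
    (continuous_aeval_real R).comp hφ
  -- box membership of the relevant points
  have hbox : ∀ (c : ℝ), c ∈ Icc (0:ℝ) 1 → ∀ u ∈ Set.pi Set.univ (fun _ : Fin d => Icc (0:ℝ) 1),
      Matrix.vecCons c (ϖ • u) ∈ Set.pi Set.univ (fun _ : Fin (d + 1) => Ioo a b) :=
    fun c hc' u hu => vecCons_mem_box ha hb hc' (smul_mem_cube hϖ hu)
  have h0I : (0:ℝ) ∈ Icc (0:ℝ) 1 := ⟨le_rfl, zero_le_one⟩
  have h1I : (1:ℝ) ∈ Icc (0:ℝ) 1 := ⟨zero_le_one, le_rfl⟩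
  rcases hϖ.1.eq_or_lt with h0 | hpos
  · -- `ϖ = 0`: all integrands are constant
    subst h0
    simp only [zero_smul, zero_sub, neg_one_mul]
    rw [setIntegral_cube_const, setIntegral_cube_const, setIntegral_cube_const]
    have hQ0 : MvPolynomial.aeval (Matrix.vecCons (0:ℝ) (0 : Fin d → ℝ)) Q ≠ 0 := by
      have := hbox 0 h0I 0 (by
        rw [Set.mem_univ_pi]; intro i; exact ⟨le_rfl, zero_le_one⟩)
      rw [zero_smul] at this
      exact hQ _ this
    have hQ1 : MvPolynomial.aeval (Matrix.vecCons (1:ℝ) (0 : Fin d → ℝ)) Q ≠ 0 := by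
      have := hbox 1 h1I 0 (by
        rw [Set.mem_univ_pi]; intro i; exact ⟨le_rfl, zero_le_one⟩)
      rw [zero_smul] at this
      exact hQ _ this
    have key := descent_at_zero P Q N₁ hN hQ0 hQ1
    simp only [Matrix.cons_zero_zero] at key ⊢
    rw [key]
    ring
  · -- `0 < ϖ ≤ 1`
    have hϖ' : ϖ ∈ Ioc (0:ℝ) 1 := ⟨hpos, hϖ.2⟩
    have hϖ0 : ϖ ≠ 0 := hpos.ne'
    -- integrability of the dilated integrand on the big cube
    have hsmul : Continuous fun z : Fin (d + 1) → ℝ => ϖ • z := continuous_const_smul ϖ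
    have hmemz : ∀ z ∈ Set.pi Set.univ (fun _ : Fin (d + 1) => Icc (0:ℝ) 1),
        ϖ • z ∈ Set.pi Set.univ (fun _ : Fin (d + 1) => Ioo a b) := by
      intro z hz
      have h := smul_mem_cube hϖ hz
      rw [Set.mem_univ_pi] at h ⊢
      intro i
      exact ⟨lt_of_lt_of_le ha (h i).1, lt_of_le_of_lt (h i).2 hb⟩
    have hint : IntegrableOn (fun z : Fin (d + 1) → ℝ =>
        (MvPolynomial.aeval (ϖ • z) (MvPolynomial.pderiv 0 P) * MvPolynomial.aeval (ϖ • z) Q -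
            MvPolynomial.aeval (ϖ • z) P * MvPolynomial.aeval (ϖ • z) (MvPolynomial.pderiv 0 Q)) /
          (MvPolynomial.aeval (ϖ • z) Q) ^ 2)
        (Set.pi Set.univ (fun _ : Fin (d + 1) => Icc (0:ℝ) 1)) volume := by
      refine ContinuousOn.integrableOn_compact (isCompact_univ_pi fun _ => isCompact_Icc) ?_
      refine (((hc _ hsmul).mul (hc _ hsmul)).sub ((hc _ hsmul).mul (hc _ hsmul))).continuousOn.div
        ((hc Q hsmul).pow 2).continuousOn fun z hz => pow_ne_zero _ (hQ _ (hmemz z hz))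
    rw [setIntegral_cube_succ_interval _ hint]
    -- the inner integral, fibrewise
    have hinner : ∀ u ∈ Set.pi Set.univ (fun _ : Fin d => Icc (0:ℝ) 1),
        (∫ t in (0:ℝ)..1,
          (MvPolynomial.aeval (ϖ • Matrix.vecCons t u) (MvPolynomial.pderiv 0 P) *
                MvPolynomial.aeval (ϖ • Matrix.vecCons t u) Q -
              MvPolynomial.aeval (ϖ • Matrix.vecCons t u) P *
                MvPolynomial.aeval (ϖ • Matrix.vecCons t u) (MvPolynomial.pderiv 0 Q)) /
            (MvPolynomial.aeval (ϖ • Matrix.vecCons t u) Q) ^ 2) =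
        (MvPolynomial.aeval (Matrix.vecCons 1 (ϖ • u)) P /
            MvPolynomial.aeval (Matrix.vecCons 1 (ϖ • u)) Q -
          MvPolynomial.aeval (Matrix.vecCons 0 (ϖ • u)) P /
            MvPolynomial.aeval (Matrix.vecCons 0 (ϖ • u)) Q) +
        (ϖ - 1) * (MvPolynomial.aeval (Matrix.vecCons ϖ (ϖ • u)) N₁ /
          (MvPolynomial.aeval (Matrix.vecCons ϖ (ϖ • u)) Q *
            MvPolynomial.aeval (Matrix.vecCons 0 (ϖ • u)) Q *
            MvPolynomial.aeval (Matrix.vecCons 1 (ϖ • u)) Q)) := by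
      intro u hu
      simp only [Matrix.smul_cons, smul_eq_mul]
      rw [integral_dilated_pderiv_zero ha hb P Q hQ hϖ' (smul_mem_cube hϖ hu)]
      exact descent_pointwise P Q N₁ hN hϖ0 (hQ _ (hbox ϖ hϖ u hu)) (hQ _ (hbox 0 h0I u hu))
        (hQ _ (hbox 1 h1I u hu))
    rw [setIntegral_congr_fun (MeasurableSet.univ_pi fun _ => measurableSet_Icc) hinner]
    -- integrability of the two pieces on the small cube
    have hpath : ∀ c : ℝ, Continuous fun u : Fin d → ℝ => Matrix.vecCons c (ϖ • u) := fun c =>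
      continuous_const.matrixVecCons (continuous_const_smul ϖ)
    have hk : IntegrableOn (fun u : Fin d → ℝ =>
        MvPolynomial.aeval (Matrix.vecCons 1 (ϖ • u)) P /
            MvPolynomial.aeval (Matrix.vecCons 1 (ϖ • u)) Q -
          MvPolynomial.aeval (Matrix.vecCons 0 (ϖ • u)) P /
            MvPolynomial.aeval (Matrix.vecCons 0 (ϖ • u)) Q)
        (Set.pi Set.univ (fun _ : Fin d => Icc (0:ℝ) 1)) volume := by
      refine ContinuousOn.integrableOn_compact (isCompact_univ_pi fun _ => isCompact_Icc) ?_
      refine ((hc P (hpath 1)).continuousOn.div (hc Q (hpath 1)).continuousOn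
        fun u hu => hQ _ (hbox 1 h1I u hu)).sub
        ((hc P (hpath 0)).continuousOn.div (hc Q (hpath 0)).continuousOn
          fun u hu => hQ _ (hbox 0 h0I u hu))
    have hΨ : IntegrableOn (fun u : Fin d → ℝ =>
        MvPolynomial.aeval (Matrix.vecCons ϖ (ϖ • u)) N₁ /
          (MvPolynomial.aeval (Matrix.vecCons ϖ (ϖ • u)) Q *
            MvPolynomial.aeval (Matrix.vecCons 0 (ϖ • u)) Q *
            MvPolynomial.aeval (Matrix.vecCons 1 (ϖ • u)) Q))
        (Set.pi Set.univ (fun _ : Fin d => Icc (0:ℝ) 1)) volume := by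
      refine ContinuousOn.integrableOn_compact (isCompact_univ_pi fun _ => isCompact_Icc) ?_
      refine (hc N₁ (hpath ϖ)).continuousOn.div
        (((hc Q (hpath ϖ)).mul (hc Q (hpath 0))).mul (hc Q (hpath 1))).continuousOn
        fun u hu => mul_ne_zero (mul_ne_zero (hQ _ (hbox ϖ hϖ u hu)) (hQ _ (hbox 0 h0I u hu)))
          (hQ _ (hbox 1 h1I u hu))
    rw [integral_add hk (hΨ.const_mul _), MeasureTheory.integral_const_mul]

/-! ### The kernel and the integrand are regular rational functions on the box -/

/-- The open box `(a,b)^n` is open. [folklore] -/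
theorem isOpen_box (n : ℕ) (a b : ℝ) : IsOpen (Set.pi Set.univ (fun _ : Fin n => Ioo a b)) :=
  isOpen_set_pi finite_univ fun _ _ => isOpen_Ioo

/-- The open box `(a,b)^n` with rational corners is `ℚ`-semialgebraic. [folklore] -/
theorem isSemialgebraic_box (n : ℕ) (a b : ℚ) :
    IsSemialgebraic ℚ (Set.pi Set.univ (fun _ : Fin n => Ioo (a:ℝ) b)) := by
  have hset : Set.pi Set.univ (fun _ : Fin n => Ioo (a:ℝ) b) =
      ⋂ i ∈ (Finset.univ : Finset (Fin n)),
        ({x : Fin n → ℝ | MvPolynomial.aeval x (MvPolynomial.C a : MvPolynomial (Fin n) ℚ) <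
            MvPolynomial.aeval x (MvPolynomial.X i : MvPolynomial (Fin n) ℚ)} ∩
          {x : Fin n → ℝ | MvPolynomial.aeval x (MvPolynomial.X i : MvPolynomial (Fin n) ℚ) <
            MvPolynomial.aeval x (MvPolynomial.C b : MvPolynomial (Fin n) ℚ)}) := by
    ext x
    simp
  rw [hset]
  exact IsSemialgebraic.biInter _ _ fun i _ =>
    (Literature.ModelTheory.ExponentialFields.isSemialgebraic_setOf_eval_lt _ _).inter
      (Literature.ModelTheory.ExponentialFields.isSemialgebraic_setOf_eval_lt _ _)

/-- The closed cube lies in the open box `(a,b)^n` when `a < 0`, `1 < b`. [folklore] -/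
theorem cube_subset_box {n : ℕ} {a b : ℝ} (ha : a < 0) (hb : 1 < b) :
    Set.pi Set.univ (fun _ : Fin n => Icc (0:ℝ) 1) ⊆ Set.pi Set.univ (fun _ : Fin n => Ioo a b) := by
  intro x hx
  rw [Set.mem_univ_pi] at hx ⊢
  exact fun i => ⟨lt_of_lt_of_le ha (hx i).1, lt_of_le_of_lt (hx i).2 hb⟩

/-- Faces of box points lie in the box: `p ∈ (a,b)^{1+d}`, `c ∈ (a,b)` ⇒
`vecCons c (vecTail p) ∈ (a,b)^{1+d}`. [folklore] -/
theorem vecCons_vecTail_mem_box {a b c : ℝ} (hc : c ∈ Ioo a b) {p : Fin (d + 1) → ℝ}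
    (hp : p ∈ Set.pi Set.univ (fun _ : Fin (d + 1) => Ioo a b)) :
    Matrix.vecCons c (Matrix.vecTail p) ∈ Set.pi Set.univ (fun _ : Fin (d + 1) => Ioo a b) := by
  rw [Set.mem_univ_pi] at hp ⊢
  refine Fin.cases ?_ (fun j => ?_)
  · simpa using hc
  · simpa [Matrix.vecTail] using hp j.succ

/-- The face polynomial: substituting the rational height `c` for `x₀`,
`(f|_{x₀ = c})(p) = f(c, p₁, …, p_d)`. [folklore] -/
theorem aeval_face (p : Fin (d + 1) → ℝ) (f : MvPolynomial (Fin (d + 1)) ℚ) (c : ℚ) :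
    MvPolynomial.aeval p (MvPolynomial.bind₁ (Fin.cons (MvPolynomial.C c)
        (fun j => MvPolynomial.X j.succ) : Fin (d + 1) → MvPolynomial (Fin (d + 1)) ℚ) f) =
      MvPolynomial.aeval (Matrix.vecCons (c:ℝ) (Matrix.vecTail p)) f := by
  rw [MvPolynomial.aeval_bind₁]
  congr 1
  ext i
  refine Fin.cases ?_ (fun j => ?_) i
  · simp
  · simp [Matrix.vecTail]

/-- **The Stokes kernel `Ψ₁ = N₁/(Q·Q(0,·)·Q(1,·))` is `ℚ`-semialgebraic on the box.**
[cite: BochnakCosteRoy1998, §2.2] -/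
theorem isSemialgebraicFunOn_kernel {a b : ℚ} (ha : (a:ℝ) < 0) (hb : 1 < (b:ℝ))
    (Q N₁ : MvPolynomial (Fin (d + 1)) ℚ)
    (hQ : ∀ p ∈ Set.pi Set.univ (fun _ : Fin (d + 1) => Ioo (a:ℝ) b), MvPolynomial.aeval p Q ≠ 0) :
    IsSemialgebraicFunOn ℚ (Set.pi Set.univ (fun _ : Fin (d + 1) => Ioo (a:ℝ) b))
      (fun p => MvPolynomial.aeval p N₁ / (MvPolynomial.aeval p Q *
        MvPolynomial.aeval (Matrix.vecCons 0 (Matrix.vecTail p)) Q *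
        MvPolynomial.aeval (Matrix.vecCons 1 (Matrix.vecTail p)) Q)) := by
  have h0 : ((0:ℚ):ℝ) ∈ Ioo (a:ℝ) b := by rw [Rat.cast_zero]; exact ⟨ha, zero_lt_one.trans hb⟩
  have h1 : ((1:ℚ):ℝ) ∈ Ioo (a:ℝ) b := by rw [Rat.cast_one]; exact ⟨ha.trans zero_lt_one, hb⟩
  set Q0 := MvPolynomial.bind₁ (Fin.cons (MvPolynomial.C 0)
    (fun j => MvPolynomial.X j.succ) : Fin (d + 1) → MvPolynomial (Fin (d + 1)) ℚ) Q with hQ0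
  set Q1 := MvPolynomial.bind₁ (Fin.cons (MvPolynomial.C 1)
    (fun j => MvPolynomial.X j.succ) : Fin (d + 1) → MvPolynomial (Fin (d + 1)) ℚ) Q with hQ1
  have hden : ∀ p ∈ Set.pi Set.univ (fun _ : Fin (d + 1) => Ioo (a:ℝ) b),
      MvPolynomial.aeval p (Q * Q0 * Q1) ≠ 0 := by
    intro p hp
    rw [map_mul, map_mul, hQ0, hQ1, aeval_face, aeval_face]
    exact mul_ne_zero (mul_ne_zero (hQ p hp) (hQ _ (vecCons_vecTail_mem_box h0 hp)))
      (hQ _ (vecCons_vecTail_mem_box h1 hp))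
  refine (isSemialgebraicFunOn_aeval_div_aeval (isSemialgebraic_box (d + 1) a b) N₁
    (Q * Q0 * Q1) hden).congr fun p _ => ?_
  simp only [map_mul, hQ0, hQ1, aeval_face, Rat.cast_zero, Rat.cast_one]

/-- **The Stokes kernel is real-analytic on the box.** [folklore] -/
theorem analyticOnNhd_kernel {a b : ℝ} (ha : a < 0) (hb : 1 < b)
    (Q N₁ : MvPolynomial (Fin (d + 1)) ℚ)
    (hQ : ∀ p ∈ Set.pi Set.univ (fun _ : Fin (d + 1) => Ioo a b), MvPolynomial.aeval p Q ≠ 0) :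
    AnalyticOnNhd ℝ (fun p => MvPolynomial.aeval p N₁ / (MvPolynomial.aeval p Q *
        MvPolynomial.aeval (Matrix.vecCons 0 (Matrix.vecTail p)) Q *
        MvPolynomial.aeval (Matrix.vecCons 1 (Matrix.vecTail p)) Q))
      (Set.pi Set.univ (fun _ : Fin (d + 1) => Ioo a b)) := by
  have hf0 : (fun p : Fin (d + 1) → ℝ => MvPolynomial.aeval (Matrix.vecCons 0 (Matrix.vecTail p)) Q) =
      fun p => MvPolynomial.aeval p (MvPolynomial.bind₁ (Fin.cons (MvPolynomial.C 0)
        (fun j => MvPolynomial.X j.succ) : Fin (d + 1) → MvPolynomial (Fin (d + 1)) ℚ) Q) := by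
    funext p; rw [aeval_face, Rat.cast_zero]
  have hf1 : (fun p : Fin (d + 1) → ℝ => MvPolynomial.aeval (Matrix.vecCons 1 (Matrix.vecTail p)) Q) =
      fun p => MvPolynomial.aeval p (MvPolynomial.bind₁ (Fin.cons (MvPolynomial.C 1)
        (fun j => MvPolynomial.X j.succ) : Fin (d + 1) → MvPolynomial (Fin (d + 1)) ℚ) Q) := by
    funext p; rw [aeval_face, Rat.cast_one]
  intro p hp
  have h0 : (0:ℝ) ∈ Ioo a b := ⟨ha, zero_lt_one.trans hb⟩
  have h1 : (1:ℝ) ∈ Ioo a b := ⟨ha.trans zero_lt_one, hb⟩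
  refine (analyticOnNhd_aeval N₁ p trivial).div ?_ ?_
  · refine ((analyticOnNhd_aeval Q p trivial).mul ?_).mul ?_
    · rw [hf0]; exact analyticOnNhd_aeval _ p trivial
    · rw [hf1]; exact analyticOnNhd_aeval _ p trivial
  · exact mul_ne_zero (mul_ne_zero (hQ p hp) (hQ _ (vecCons_vecTail_mem_box h0 hp)))
      (hQ _ (vecCons_vecTail_mem_box h1 hp))

/-- **The integrand `h = ∂₀(P/Q)` is `ℚ`-semialgebraic on the box.**
[cite: BochnakCosteRoy1998, §2.2] -/
theorem isSemialgebraicFunOn_pderivQuot (a b : ℚ) (P Q : MvPolynomial (Fin (d + 1)) ℚ)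
    (hQ : ∀ p ∈ Set.pi Set.univ (fun _ : Fin (d + 1) => Ioo (a:ℝ) b), MvPolynomial.aeval p Q ≠ 0) :
    IsSemialgebraicFunOn ℚ (Set.pi Set.univ (fun _ : Fin (d + 1) => Ioo (a:ℝ) b))
      (fun p => (MvPolynomial.aeval p (MvPolynomial.pderiv 0 P) * MvPolynomial.aeval p Q -
          MvPolynomial.aeval p P * MvPolynomial.aeval p (MvPolynomial.pderiv 0 Q)) /
        (MvPolynomial.aeval p Q) ^ 2) := by
  refine (isSemialgebraicFunOn_aeval_div_aeval (isSemialgebraic_box (d + 1) a b)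
    (MvPolynomial.pderiv 0 P * Q - P * MvPolynomial.pderiv 0 Q) (Q ^ 2)
    (fun p hp => by rw [map_pow]; exact pow_ne_zero _ (hQ p hp))).congr fun p _ => ?_
  simp only [map_sub, map_mul, map_pow]

/-- **The integrand `h = ∂₀(P/Q)` is real-analytic on the box.** [folklore] -/
theorem analyticOnNhd_pderivQuot {a b : ℝ} (P Q : MvPolynomial (Fin (d + 1)) ℚ)
    (hQ : ∀ p ∈ Set.pi Set.univ (fun _ : Fin (d + 1) => Ioo a b), MvPolynomial.aeval p Q ≠ 0) :
    AnalyticOnNhd ℝ (fun p => (MvPolynomial.aeval p (MvPolynomial.pderiv 0 P) *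
          MvPolynomial.aeval p Q -
        MvPolynomial.aeval p P * MvPolynomial.aeval p (MvPolynomial.pderiv 0 Q)) /
        (MvPolynomial.aeval p Q) ^ 2)
      (Set.pi Set.univ (fun _ : Fin (d + 1) => Ioo a b)) := fun p hp =>
  (((analyticOnNhd_aeval _ p trivial).mul (analyticOnNhd_aeval Q p trivial)).sub
    ((analyticOnNhd_aeval P p trivial).mul (analyticOnNhd_aeval _ p trivial))).div
    ((analyticOnNhd_aeval Q p trivial).pow 2) (pow_ne_zero _ (hQ p hp))

end KZ.StokesDescent

end Literature.NumberTheory.Transcendental
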